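import Summits.HubbardSuperconductivity.HubbardSuperconductivity.Theorems.AnisotropyChordTransferFibre3FinX3Eval

/-!
# Route `AnisotropyChord` / H0 rotor rung: FIN per-`L` GM₃ (X5), `L = 26` — rows `N₁` / D / side-condition cell facts, part `p13`

Kernel facts (`decide +kernel`) for cert cells 45, 46 of the per-`L` grid of `L = 26`: `xbnCellAny2` (row `N₁` on XB2 point wedges recomputed in the kernel, exporting the literal brackets `nt ⊇ T⁺ − 3λ₂` and `tb ⊇ T⁺·D`), `xdCellAnyN0` (row D, reads `nt`), `sdCellAnyZN` (side condition, reads `nt`); evaluators `…FinX3Eval` / `…FinX5Eval`; constants from the compiled design probe (x3probe/x3plan, margins c ×0.985, b ×1.03, aD ×1.03); assembled in `…FinX5GM3TwentySix`.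
Prover seat `hubbard-h0-rotor-p3` g8; helper for piece A = stmt-HubbardSuperconductivity-23918 of rung 19089 (`--supports`, helper class).
WHAT THIS IS NOT: nothing here proves superconductivity in the Hubbard model (rotor TARGET as worded stays FALSE, g15 verdict); kernel facts for the FIN certificate of ONE conditional reduction.  Tree imports only; zero data; standard axioms.
-/

set_option linter.dupNamespace false
set_option autoImplicit false

namespace Summit.HubbardSuperconductivity.HubbardSuperconductivity.Theorems.AnisotropyChord.Transfer.Fibre3

namespace FinXD

open FinXB FinCell Hole2

set_option maxHeartbeats 4000000 in
/-- row `N₁` of cell 45 of `L = 26` (`c = 3/5`), exporting `nt`, `tb`. [folklore] -/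
theorem xn26_45 : xbnCellAny2 26 (49/50 : ℚ) 240375185510388 246384565148148 (3/5 : ℚ) ((-3355488398454 : ℤ), (3544453324991 : ℤ)) ((717765666731609 : ℤ), (742702550170536 : ℤ)) = true := by decide +kernel

set_option maxHeartbeats 4000000 in
/-- row D of cell 45 of `L = 26` (`aD = 83/1000`). [folklore] -/
theorem xd26_45 : xdCellAnyN0 26 (49/50 : ℚ) 240375185510388 246384565148148 (83/1000 : ℚ) ((-3355488398454 : ℤ), (3544453324991 : ℤ)) = true := by decide +kernel

set_option maxHeartbeats 4000000 in
/-- side condition of cell 45 of `L = 26` (`c, b = 59/100, aD`). [folklore] -/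
theorem sd26_45 : sdCellAnyZN 26 (49/50 : ℚ) 100 240375185510388 246384565148148 ((3/5 : ℚ), (59 : ℕ), (83/1000 : ℚ)) ((-3355488398454 : ℤ), (3544453324991 : ℤ)) = true := by decide +kernel

set_option maxHeartbeats 4000000 in
/-- row `N₁` of cell 46 of `L = 26` (`c = 3/5`), exporting `nt`, `tb`. [folklore] -/
theorem xn26_46 : xbnCellAny2 26 (49/50 : ℚ) 246384565148148 252544179276852 (3/5 : ℚ) ((-3335011535453 : ℤ), (3548529522816 : ℤ)) ((735814172472861 : ℤ), (761185578789502 : ℤ)) = true := by decide +kernel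

set_option maxHeartbeats 4000000 in
/-- row D of cell 46 of `L = 26` (`aD = 83/1000`). [folklore] -/
theorem xd26_46 : xdCellAnyN0 26 (49/50 : ℚ) 246384565148148 252544179276852 (83/1000 : ℚ) ((-3335011535453 : ℤ), (3548529522816 : ℤ)) = true := by decide +kernel

set_option maxHeartbeats 4000000 in
/-- side condition of cell 46 of `L = 26` (`c, b = 60/100, aD`). [folklore] -/
theorem sd26_46 : sdCellAnyZN 26 (49/50 : ℚ) 100 246384565148148 252544179276852 ((3/5 : ℚ), (60 : ℕ), (83/1000 : ℚ)) ((-3335011535453 : ℤ), (3548529522816 : ℤ)) = true := by decide +kernel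

end FinXD

end Summit.HubbardSuperconductivity.HubbardSuperconductivity.Theorems.AnisotropyChord.Transfer.Fibre3
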